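import Mathlib.Topology.Algebra.Category.ProfiniteGrp.Limits
import Mathlib.FieldTheory.Galois.Profinite
import Mathlib.FieldTheory.IsAlgClosed.Basic
import Literature.AnabelianGeometry.EtaleTheta.SettingBridge
import HarnessLib

/-!
# [EtTh] §1: «decomposition groups of closed points lie in `Π^tp_Y`» is a THEOREM of the root interface
# — parameter (P3) `OncePuncturedData.decomp_le_ker_toZ` derived with NO section and NO compactness datum

Mochizuki, *The étale theta function …*, Publ. RIMS **45** (2009), §1 p. 12–13: the universal
graph-covering of the dual graph of the special fibre gives `Π^tp_X ↠ Z (≅ ℤ)` with kernel `Π^tp_Y`; a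
decomposition group `D_x ⊆ Π^tp_X` of a closed point `x` is an extension of an open subgroup of `G_K` by
`I_x` (`≅ Ẑ(1)` at a cusp, trivial otherwise, [SemiAnbd] §6 p. 71), hence dies in the torsion-free
discrete `Z`: `D_x ⊆ Π^tp_Y` [cite: MochizukiEtTh2009, §1 p.13] [cite: MochizukiSemiAnbd2006, §6 p.71].
Cell abc-iut, block C / W6, seat abc-iut-w6-d092 (gen 4); PROOF-ONLY (0 `def`, 0 new `Prop`), row
«P3-UNCONDITIONAL» (L2 13:00Z census C-block; GAP-LEDGER D-G-w6d069-1 named «Hom(profinite, ℤ) = 0»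
as the missing classical input).

WHAT IS PROVED.
* §A `monoidHom_apply_eq_one_of_compactSpace_of_totallyDisconnectedSpace` — **every ABSTRACT group
  homomorphism from a profinite group to `ℤ` is trivial** (no continuity assumed), in Mathlib currency
  without limits of sequences: along `P ≃ₜ* lim_U P/U` (`ProfiniteGrp.continuousMulEquivLimitto…`) the
  family `(xU)_U` splits EXPLICITLY as `u·v`, `u = (x^{c(n)}U)`, `v = (x^{1−c(n)}U)`, `c(n) ≡ 0 mod 2^{v₂(n)}`,
  `≡ 1` mod the odd part of `n = [P:U]` (Bezout); `u` is a `2^j`-th and `v` a `3^j`-th power for every `j`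
  (again explicit compatible families), so `f(x) ∈ ⋂ⱼ 2^j ℤ + ⋂ⱼ 3^j ℤ = 0`.
* §B `TemperedCurve.decomp_le_ker_of_hom_int` — `D_x ≤ Ker φ` for EVERY abstract `φ : Π^temp_{X_K} →* ℤ`
  and every closed point `x`, from the ROOT `TemperedCurve` fields: `I_x = D_x ⊓ Ker(aug)` is profinite
  (`inertia_equiv_zHat`) or trivial (`inertia_eq_bot`) so `φ(I_x) = 1` by §A; `φ|_{D_x}` then factors
  through the abstract group `aug(D_x)`, OPEN (`isOpen_aug_decomp`) hence closed, compact, profinite in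
  `G_{ℚ_p}` — §A again. Hence `ThetaSetting.decomp_le_ker_toZ_of_root` (any point, cusp or not) and the
  REDUNDANCY of (P3) (`decomp_le_ker_toZ_field_redundant`; kernel certificate
  `nonempty_oncePuncturedData_of_P1_P2_P4_P5` assembles `OncePuncturedData` from (P1), (P2), (P4), (P5) +
  group-level data alone), independently of abc-iut-L2-d3's continuous-section route.

HONEST FRAMING: elementary group theory over the typed interfaces; [EtTh]/[SemiAnbd] are refereed;
nothing here bears on [IUTchIII] Cor. 3.12 or takes a side; typed ≠ proved elsewhere.
-/
open CategoryTheory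

universe u

namespace Literature.AnabelianGeometry.EtaleTheta

/-! ## §A. Abstract homomorphisms from a profinite group to `ℤ` are trivial -/

namespace DecompLeKerToZ

/-- Powers in Mathlib's explicit limit of profinite groups are pointwise. [cite: MochizukiSemiAnbd2006, §6 p.71] -/
theorem limit_pow_val {J : Type u} [SmallCategory J] (F : J ⥤ ProfiniteGrp.{u})
    (z : ProfiniteGrp.limit F) (k : ℕ) (j : J) : (z ^ k).val j = (z.val j) ^ k := by
  induction k with
  | zero => rw [pow_zero, pow_zero, ProfiniteGrp.limit_one_val]
  | succ k ih => rw [pow_succ, pow_succ, ProfiniteGrp.limit_mul_val, ih]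

/-- In `lim_U P/U` (`U` open normal in the profinite `P`), an exponent function `g` on indices
compatible modulo divisors defines the family `(x^{g [P:U]} U)_U`. [cite: MochizukiSemiAnbd2006, §6 p.71] -/
theorem exists_zpow_family (P : ProfiniteGrp.{u}) (x : P) (g : ℕ → ℤ)
    (hg : ∀ m n : ℕ, m ≠ 0 → n ≠ 0 → m ∣ n → (m : ℤ) ∣ g n - g m) :
    ∃ z : ProfiniteGrp.limit P.diagram, ∀ U : OpenNormalSubgroup P,
      z.1 U = (QuotientGroup.mk (x ^ g U.toSubgroup.index) : P ⧸ U.toSubgroup) := by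
  refine ⟨⟨fun U => (QuotientGroup.mk (x ^ g U.toSubgroup.index) : P ⧸ U.toSubgroup), ?_⟩, fun U => rfl⟩
  intro U V π
  change (QuotientGroup.mk (x ^ g U.toSubgroup.index) : P ⧸ V.toSubgroup) =
    QuotientGroup.mk (x ^ g V.toSubgroup.index)
  rw [QuotientGroup.eq, ← zpow_neg, ← zpow_add, neg_add_eq_sub, ← neg_sub, zpow_neg]
  refine inv_mem ?_
  obtain ⟨t, ht⟩ := hg _ _ Subgroup.index_ne_zero_of_finite Subgroup.index_ne_zero_of_finite
    (Subgroup.index_dvd_of_le (leOfHom π))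
  rw [ht, zpow_mul, zpow_natCast]
  exact V.toSubgroup.zpow_mem (V.toSubgroup.pow_index_mem x) t

/-- Bezout 1: `c ∈ ℤ` with `2^{v₂(n)} ∣ c`, `c ≡ 1` mod the odd part of `n ≠ 0`.
[cite: MochizukiSemiAnbd2006, §6 p.71] -/
theorem exists_crt_idempotent (n : ℕ) :
    ∃ c : ℤ, n ≠ 0 → ((ordProj[2] n : ℕ) : ℤ) ∣ c ∧ ((ordCompl[2] n : ℕ) : ℤ) ∣ c - 1 := by
  by_cases hn : n = 0
  · exact ⟨0, fun h => (h hn).elim⟩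
  have hcop : IsCoprime ((ordProj[2] n : ℕ) : ℤ) ((ordCompl[2] n : ℕ) : ℤ) :=
    Nat.isCoprime_iff_coprime.mpr ((Nat.coprime_ordCompl Nat.prime_two hn).pow_left _)
  obtain ⟨a, b, hab⟩ := hcop
  refine ⟨a * (ordProj[2] n : ℕ), fun _ => ⟨Dvd.intro_left a rfl, ?_⟩⟩
  exact ⟨-b, by linear_combination hab⟩

/-- Bezout 2: `e ∈ ℤ` with `2^{v₂(n)} ∣ e`, `2^j·e ≡ 1` mod the odd part of `n ≠ 0`.
[cite: MochizukiSemiAnbd2006, §6 p.71] -/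
theorem exists_crt_root_two (n j : ℕ) :
    ∃ e : ℤ, n ≠ 0 → ((ordProj[2] n : ℕ) : ℤ) ∣ e ∧ ((ordCompl[2] n : ℕ) : ℤ) ∣ 2 ^ j * e - 1 := by
  by_cases hn : n = 0
  · exact ⟨0, fun h => (h hn).elim⟩
  obtain ⟨c, hc⟩ := exists_crt_idempotent n
  obtain ⟨hcA, hcB⟩ := hc hn
  have hcop : IsCoprime ((2 : ℤ) ^ j) ((ordCompl[2] n : ℕ) : ℤ) := by
    have := Nat.isCoprime_iff_coprime.mpr ((Nat.coprime_ordCompl Nat.prime_two hn).pow_left j)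
    simpa using this
  obtain ⟨s, t, hst⟩ := hcop
  refine ⟨c * s, fun _ => ⟨Dvd.dvd.mul_right hcA s, ?_⟩⟩
  have h1 : (2 : ℤ) ^ j * (c * s) - 1 = (c - 1) - c * t * ((ordCompl[2] n : ℕ) : ℤ) := by
    linear_combination c * hst
  rw [h1]; exact dvd_sub hcB (Dvd.intro_left (c * t) rfl)

/-- Bezout 3: `e' ∈ ℤ` divisible by the odd part of `n ≠ 0` with `3^j·e' ≡ 1 (mod 2^{v₂(n)})`.
[cite: MochizukiSemiAnbd2006, §6 p.71] -/
theorem exists_crt_root_three (n j : ℕ) :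
    ∃ e : ℤ, n ≠ 0 → ((ordCompl[2] n : ℕ) : ℤ) ∣ e ∧ ((ordProj[2] n : ℕ) : ℤ) ∣ 3 ^ j * e - 1 := by
  by_cases hn : n = 0
  · exact ⟨0, fun h => (h hn).elim⟩
  obtain ⟨c, hc⟩ := exists_crt_idempotent n
  obtain ⟨hcA, hcB⟩ := hc hn
  have hcop : IsCoprime ((3 : ℤ) ^ j) ((ordProj[2] n : ℕ) : ℤ) := by
    have h23 : Nat.Coprime (3 ^ j) (ordProj[2] n) := Nat.Coprime.pow _ _ (by norm_num)
    have := Nat.isCoprime_iff_coprime.mpr h23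
    simpa using this
  obtain ⟨s, t, hst⟩ := hcop
  refine ⟨(1 - c) * s, fun _ => ⟨?_, ?_⟩⟩
  · have : (1 - c) = -(c - 1) := by ring
    rw [this]
    exact Dvd.dvd.mul_right (dvd_neg.mpr hcB) s
  · have h1 : (3 : ℤ) ^ j * ((1 - c) * s) - 1 = -c - (1 - c) * t * ((ordProj[2] n : ℕ) : ℤ) := by
      linear_combination (1 - c) * hst
    rw [h1]; exact dvd_sub (dvd_neg.mpr hcA) (Dvd.intro_left ((1 - c) * t) rfl)

/-- CRT recombination: divisibility by the `2`-part and by the odd part of `m` gives divisibility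
by `m`. [cite: MochizukiSemiAnbd2006, §6 p.71] -/
theorem dvd_of_ordProj_dvd_of_ordCompl_dvd {m : ℕ} {d : ℤ}
    (hA : ((ordProj[2] m : ℕ) : ℤ) ∣ d) (hB : ((ordCompl[2] m : ℕ) : ℤ) ∣ d) : (m : ℤ) ∣ d := by
  by_cases hm : m = 0
  · subst hm
    simpa using hB
  have hcop : IsCoprime ((ordProj[2] m : ℕ) : ℤ) ((ordCompl[2] m : ℕ) : ℤ) :=
    Nat.isCoprime_iff_coprime.mpr ((Nat.coprime_ordCompl Nat.prime_two hm).pow_left _)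
  have := hcop.mul_dvd hA hB
  rwa [← Nat.cast_mul, Nat.ordProj_mul_ordCompl_eq_self] at this

end DecompLeKerToZ

open DecompLeKerToZ in
/-- **Every abstract group homomorphism from a profinite group to `ℤ` is trivial** (no continuity
hypothesis on `f`; `ℤ` written multiplicatively). Classical; here by an explicit splitting
`x = u·v` in `lim_U P/U` with `u` infinitely `2`-divisible and `v` infinitely `3`-divisible.
[cite: MochizukiSemiAnbd2006, §6 p.71] -/
theorem monoidHom_apply_eq_one_of_compactSpace_of_totallyDisconnectedSpace {G : Type u} [Group G]
    [TopologicalSpace G] [IsTopologicalGroup G] [CompactSpace G] [TotallyDisconnectedSpace G]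
    (f : G →* Multiplicative ℤ) (x : G) : f x = 1 := by
  let P : ProfiniteGrp.{u} := ProfiniteGrp.of G
  let e := ProfiniteGrp.continuousMulEquivLimittoFiniteQuotientFunctor P
  let F : ProfiniteGrp.limit P.diagram →* Multiplicative ℤ := f.comp e.symm.toMonoidHom
  have hFx : f x = F (e x) := by
    change f x = f (e.symm (e x)); rw [ContinuousMulEquiv.symm_apply_apply]
  -- (1) an element admitting `q^j`-th roots for every `j` (`q ≥ 2`) dies under `F`
  have hdiv : ∀ q : ℕ, 2 ≤ q → ∀ z : ProfiniteGrp.limit P.diagram,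
      (∀ j : ℕ, ∃ w : ProfiniteGrp.limit P.diagram, w ^ (q ^ j) = z) → F z = 1 := by
    intro q hq z hz
    set t := Multiplicative.toAdd (F z) with ht
    have hdvd : ∀ j : ℕ, ((q : ℤ) ^ j) ∣ t := by
      intro j
      obtain ⟨w, hw⟩ := hz j
      refine ⟨Multiplicative.toAdd (F w), ?_⟩
      rw [ht, ← hw, map_pow, toAdd_pow, nsmul_eq_mul]
      push_cast
      ring
    have h0 : t = 0 := by
      apply Int.eq_zero_of_abs_lt_dvd (hdvd t.natAbs)
      rw [Int.abs_eq_natAbs]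
      have h1 : (t.natAbs : ℤ) < (2 : ℤ) ^ t.natAbs := by exact_mod_cast t.natAbs.lt_two_pow_self
      exact h1.trans_le (pow_le_pow_left₀ (by norm_num) (by exact_mod_cast hq) _)
    rw [← ofAdd_toAdd (F z), ← ht, h0]
    rfl
  -- (2) the CRT idempotent exponents `c n` (≡ 0 mod the 2-part, ≡ 1 mod the odd part of `n`)
  choose c hc using DecompLeKerToZ.exists_crt_idempotent
  have hc_compat : ∀ m n : ℕ, m ≠ 0 → n ≠ 0 → m ∣ n → (m : ℤ) ∣ c n - c m := by
    intro m n hm hn hmn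
    apply DecompLeKerToZ.dvd_of_ordProj_dvd_of_ordCompl_dvd
    · exact dvd_sub ((Int.natCast_dvd_natCast.mpr (Nat.ordProj_dvd_ordProj_of_dvd hn hmn 2)).trans
        (hc n hn).1) (hc m hm).1
    · have h1 : ((ordCompl[2] m : ℕ) : ℤ) ∣ c n - 1 :=
        (Int.natCast_dvd_natCast.mpr (Nat.ordCompl_dvd_ordCompl_of_dvd hmn 2)).trans (hc n hn).2
      have h2 : c n - c m = (c n - 1) - (c m - 1) := by ring
      rw [h2]; exact dvd_sub h1 (hc m hm).2
  -- (3) the splitting `e x = u · v`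
  obtain ⟨u, hu⟩ := DecompLeKerToZ.exists_zpow_family P x c hc_compat
  obtain ⟨v, hv⟩ := DecompLeKerToZ.exists_zpow_family P x (fun n => 1 - c n) (by
    intro m n hm hn hmn
    have h1 : (1 - c n) - (1 - c m) = -(c n - c m) := by ring
    rw [h1]
    exact dvd_neg.mpr (hc_compat m n hm hn hmn))
  have huv : u * v = e x := by
    apply ProfiniteGrp.limit_ext
    intro U
    have key : (QuotientGroup.mk (x ^ c U.toSubgroup.index) : P ⧸ U.toSubgroup) *
        QuotientGroup.mk (x ^ (1 - c U.toSubgroup.index)) = QuotientGroup.mk x := by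
      rw [← QuotientGroup.mk_mul, ← zpow_add]
      have h1 : c U.toSubgroup.index + (1 - c U.toSubgroup.index) = 1 := by ring
      rw [h1, zpow_one]
    rw [ProfiniteGrp.limit_mul_val, hu U, hv U]
    exact key
  -- (4) `u` is a `2^j`-th power for every `j`
  have hu1 : F u = 1 := by
    refine hdiv 2 le_rfl u fun j => ?_
    choose ef hef using fun n => DecompLeKerToZ.exists_crt_root_two n j
    obtain ⟨w, hw⟩ := DecompLeKerToZ.exists_zpow_family P x ef (by
      intro m n hm hn hmn
      obtain ⟨hAn, hBn⟩ := hef n hn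
      obtain ⟨hAm, hBm⟩ := hef m hm
      apply DecompLeKerToZ.dvd_of_ordProj_dvd_of_ordCompl_dvd
      · exact dvd_sub ((Int.natCast_dvd_natCast.mpr (Nat.ordProj_dvd_ordProj_of_dvd hn hmn 2)).trans
          hAn) hAm
      · have hBn' : ((ordCompl[2] m : ℕ) : ℤ) ∣ 2 ^ j * ef n - 1 :=
          (Int.natCast_dvd_natCast.mpr (Nat.ordCompl_dvd_ordCompl_of_dvd hmn 2)).trans hBn
        have h2 : ((ordCompl[2] m : ℕ) : ℤ) ∣ 2 ^ j * (ef n - ef m) := by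
          have h3 : (2 : ℤ) ^ j * (ef n - ef m) = (2 ^ j * ef n - 1) - (2 ^ j * ef m - 1) := by ring
          rw [h3]
          exact dvd_sub hBn' hBm
        have hcop : IsCoprime ((ordCompl[2] m : ℕ) : ℤ) ((2 : ℤ) ^ j) := by
          have h4 := Nat.isCoprime_iff_coprime.mpr
            ((Nat.coprime_ordCompl Nat.prime_two hm).pow_left j).symm
          simpa using h4
        exact hcop.dvd_of_dvd_mul_left h2)
    refine ⟨w, ProfiniteGrp.limit_ext _ _ _ fun U => ?_⟩
    have hn : U.toSubgroup.index ≠ 0 := Subgroup.index_ne_zero_of_finite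
    obtain ⟨hA, hB⟩ := hef _ hn
    have hdvd : (U.toSubgroup.index : ℤ) ∣
        -(ef U.toSubgroup.index * ((2 ^ j : ℕ) : ℤ)) + c U.toSubgroup.index := by
      apply DecompLeKerToZ.dvd_of_ordProj_dvd_of_ordCompl_dvd
      · exact dvd_add (dvd_neg.mpr (Dvd.dvd.mul_right hA _)) (hc _ hn).1
      · have h1 : -(ef U.toSubgroup.index * ((2 ^ j : ℕ) : ℤ)) + c U.toSubgroup.index =
            (c U.toSubgroup.index - 1) - (2 ^ j * ef U.toSubgroup.index - 1) := by push_cast; ring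
        rw [h1]
        exact dvd_sub (hc _ hn).2 hB
    have key : (QuotientGroup.mk (x ^ ef U.toSubgroup.index) : P ⧸ U.toSubgroup) ^ 2 ^ j =
        QuotientGroup.mk (x ^ c U.toSubgroup.index) := by
      rw [← QuotientGroup.mk_pow, ← zpow_natCast, ← zpow_mul, QuotientGroup.eq, ← zpow_neg, ← zpow_add]
      obtain ⟨t, ht⟩ := hdvd
      rw [ht, zpow_mul, zpow_natCast]
      exact U.toSubgroup.zpow_mem (U.toSubgroup.pow_index_mem x) t
    rw [DecompLeKerToZ.limit_pow_val, hw U, hu U]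
    exact key
  -- (5) `v` is a `3^j`-th power for every `j`
  have hv1 : F v = 1 := by
    refine hdiv 3 (by norm_num) v fun j => ?_
    choose ef hef using fun n => DecompLeKerToZ.exists_crt_root_three n j
    obtain ⟨w, hw⟩ := DecompLeKerToZ.exists_zpow_family P x ef (by
      intro m n hm hn hmn
      obtain ⟨hBn, hAn⟩ := hef n hn
      obtain ⟨hBm, hAm⟩ := hef m hm
      apply DecompLeKerToZ.dvd_of_ordProj_dvd_of_ordCompl_dvd
      · have hAn' : ((ordProj[2] m : ℕ) : ℤ) ∣ 3 ^ j * ef n - 1 :=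
          (Int.natCast_dvd_natCast.mpr (Nat.ordProj_dvd_ordProj_of_dvd hn hmn 2)).trans hAn
        have h2 : ((ordProj[2] m : ℕ) : ℤ) ∣ 3 ^ j * (ef n - ef m) := by
          have h3 : (3 : ℤ) ^ j * (ef n - ef m) = (3 ^ j * ef n - 1) - (3 ^ j * ef m - 1) := by ring
          rw [h3]
          exact dvd_sub hAn' hAm
        have hcop : IsCoprime ((ordProj[2] m : ℕ) : ℤ) ((3 : ℤ) ^ j) := by
          have h23 : Nat.Coprime (ordProj[2] m) (3 ^ j) := Nat.Coprime.pow _ _ (by norm_num)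
          have h4 := Nat.isCoprime_iff_coprime.mpr h23
          simpa using h4
        exact hcop.dvd_of_dvd_mul_left h2
      · exact dvd_sub ((Int.natCast_dvd_natCast.mpr (Nat.ordCompl_dvd_ordCompl_of_dvd hmn 2)).trans
          hBn) hBm)
    refine ⟨w, ProfiniteGrp.limit_ext _ _ _ fun U => ?_⟩
    have hn : U.toSubgroup.index ≠ 0 := Subgroup.index_ne_zero_of_finite
    obtain ⟨hB, hA⟩ := hef _ hn
    have hdvd : (U.toSubgroup.index : ℤ) ∣
        -(ef U.toSubgroup.index * ((3 ^ j : ℕ) : ℤ)) + (1 - c U.toSubgroup.index) := by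
      apply DecompLeKerToZ.dvd_of_ordProj_dvd_of_ordCompl_dvd
      · have h1 : -(ef U.toSubgroup.index * ((3 ^ j : ℕ) : ℤ)) + (1 - c U.toSubgroup.index) =
            -(3 ^ j * ef U.toSubgroup.index - 1) - c U.toSubgroup.index := by push_cast; ring
        rw [h1]
        exact dvd_sub (dvd_neg.mpr hA) (hc _ hn).1
      · have h1 : -(ef U.toSubgroup.index * ((3 ^ j : ℕ) : ℤ)) + (1 - c U.toSubgroup.index) =
            -(ef U.toSubgroup.index * ((3 ^ j : ℕ) : ℤ)) - (c U.toSubgroup.index - 1) := by ring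
        rw [h1]
        exact dvd_sub (dvd_neg.mpr (Dvd.dvd.mul_right hB _)) (hc _ hn).2
    have key : (QuotientGroup.mk (x ^ ef U.toSubgroup.index) : P ⧸ U.toSubgroup) ^ 3 ^ j =
        QuotientGroup.mk (x ^ (1 - c U.toSubgroup.index)) := by
      rw [← QuotientGroup.mk_pow, ← zpow_natCast, ← zpow_mul, QuotientGroup.eq, ← zpow_neg, ← zpow_add]
      obtain ⟨t, ht⟩ := hdvd
      rw [ht, zpow_mul, zpow_natCast]
      exact U.toSubgroup.zpow_mem (U.toSubgroup.pow_index_mem x) t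
    rw [DecompLeKerToZ.limit_pow_val, hw U, hv U]
    exact key
  -- (6) conclusion
  rw [hFx, ← huv, map_mul, hu1, hv1, mul_one]

/-! ## §B. Decomposition groups of closed points die in every homomorphism `Π^tp_X → ℤ` -/

end Literature.AnabelianGeometry.EtaleTheta

namespace Literature.AnabelianGeometry.SemiGraphs.TemperedCurve

open Literature.AnabelianGeometry.EtaleTheta

variable {p : ℕ} [Fact p.Prime] (X : TemperedCurve p)

/-- **The inertia part dies**: for a closed point `x` of `X_K`, every abstract homomorphism
`Π^temp_{X_K} → ℤ` is trivial on `I_x = D_x ∩ Δ^temp_X` — profinite (`≅ Ẑ(1)`) at a cusp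
(`inertia_equiv_zHat`), trivial otherwise (`inertia_eq_bot`). [cite: MochizukiSemiAnbd2006, §6 p.71] -/
theorem apply_eq_one_of_mem_inertia (φ : X.PiTemp →* Multiplicative ℤ) (x : X.Pt) {i : X.PiTemp}
    (hi : i ∈ X.decomp x ⊓ X.aug.toMonoidHom.ker) : φ i = 1 := by
  by_cases hx : X.IsCusp x
  · obtain ⟨eI⟩ := X.inertia_equiv_zHat x hx
    haveI : CompactSpace ↥(X.decomp x ⊓ X.aug.toMonoidHom.ker) :=
      Homeomorph.compactSpace eI.symm.toHomeomorph
    haveI : TotallyDisconnectedSpace ↥(X.decomp x ⊓ X.aug.toMonoidHom.ker) :=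
      Homeomorph.totallyDisconnectedSpace eI.symm.toHomeomorph
    exact monoidHom_apply_eq_one_of_compactSpace_of_totallyDisconnectedSpace
      (φ.comp (X.decomp x ⊓ X.aug.toMonoidHom.ker).subtype) ⟨i, hi⟩
  · rw [X.inertia_eq_bot x hx, Subgroup.mem_bot] at hi
    rw [hi, map_one]

/-- **Decomposition groups lie in the kernel of every homomorphism `Π^temp_{X_K} → ℤ`** (abstract,
no continuity needed): `D_x` is an extension of the OPEN subgroup `aug(D_x) ≤ G_{ℚ_p}`
(`isOpen_aug_decomp`; open ⇒ closed ⇒ compact ⇒ profinite) by `I_x`, and abstract homomorphisms from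
profinite groups to `ℤ` vanish (§A). [cite: MochizukiSemiAnbd2006, §6 p.71] -/
theorem decomp_le_ker_of_hom_int (φ : X.PiTemp →* Multiplicative ℤ) (x : X.Pt) :
    X.decomp x ≤ φ.ker := by
  intro d hd
  rw [MonoidHom.mem_ker]
  -- `A = aug(D_x)`, an open — hence closed, compact, profinite — subgroup of `G_{ℚ_p}`
  let A : Subgroup (GQp p) := (X.decomp x).map X.aug.toMonoidHom
  have hAopen : IsOpen (A : Set (GQp p)) := by
    have hA : (A : Set (GQp p)) = X.aug '' (X.decomp x : Set X.PiTemp) := Subgroup.coe_map _ _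
    rw [hA]
    exact X.isOpen_aug_decomp x
  haveI : CompactSpace (GQp p) :=
    inferInstanceAs (CompactSpace (AlgebraicClosure ℚ_[p] ≃ₐ[ℚ_[p]] AlgebraicClosure ℚ_[p]))
  haveI : TotallyDisconnectedSpace (GQp p) :=
    inferInstanceAs (TotallyDisconnectedSpace (AlgebraicClosure ℚ_[p] ≃ₐ[ℚ_[p]] AlgebraicClosure ℚ_[p]))
  haveI : CompactSpace A :=
    isCompact_iff_compactSpace.mp (Subgroup.isClosed_of_isOpen A hAopen).isCompact
  -- the augmentation restricted to `D_x`, onto `A`; `φ|_{D_x}` factors through it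
  let augD : ↥(X.decomp x) →* A := X.aug.toMonoidHom.subgroupMap (X.decomp x)
  have hsurj : Function.Surjective augD := X.aug.toMonoidHom.subgroupMap_surjective (X.decomp x)
  let φD : ↥(X.decomp x) →* Multiplicative ℤ := φ.comp (X.decomp x).subtype
  have hker : augD.ker ≤ φD.ker := by
    intro h hh
    rw [MonoidHom.mem_ker] at hh ⊢
    have h1 : X.aug h.1 = 1 := congrArg Subtype.val hh
    exact X.apply_eq_one_of_mem_inertia φ x ⟨h.2, h1⟩
  let ψ : A →* Multiplicative ℤ :=
    augD.liftOfRightInverse (Function.surjInv hsurj) (Function.rightInverse_surjInv hsurj) ⟨φD, hker⟩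
  have hψ : ψ (augD ⟨d, hd⟩) = φD ⟨d, hd⟩ :=
    augD.liftOfRightInverse_comp_apply (Function.surjInv hsurj) (Function.rightInverse_surjInv hsurj)
      ⟨φD, hker⟩ ⟨d, hd⟩
  have h0 := monoidHom_apply_eq_one_of_compactSpace_of_totallyDisconnectedSpace ψ (augD ⟨d, hd⟩)
  rw [hψ] at h0
  exact h0

end Literature.AnabelianGeometry.SemiGraphs.TemperedCurve

namespace Literature.AnabelianGeometry.EtaleTheta.ThetaSetting

open Literature.AnabelianGeometry.SemiGraphs
open scoped Pointwise

variable {p : ℕ} [Fact p.Prime] (D : ThetaSetting p)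

/-- **(P3) at the root, for every closed point**: `D_x ≤ Ker(Π^tp_X ↠ Z) = Π^tp_Y` for a `ThetaSetting`
`D` and ANY point `x` of `X̄_K` (cusp or not), from the root `TemperedCurve` fields alone (no section, no
compactness datum for `D_x`). [cite: MochizukiEtTh2009, §1 p.13] -/
theorem decomp_le_ker_toZ_of_root (x : D.Pt) : D.decomp x ≤ D.toZ.ker :=
  D.toTemperedCurve.decomp_le_ker_of_hom_int D.toZ x

/-- **The parameter (P3) `OncePuncturedData.decomp_le_ker_toZ` (`SettingBridge.lean`) is redundant**:
its exact field type is a theorem of every `ThetaSetting`. (Census note for the v-next of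
`OncePuncturedData`: the field may be dropped or kept as this derived lemma.)
[cite: MochizukiEtTh2009, §1 p.13] -/
theorem decomp_le_ker_toZ_field_redundant : ∀ x : D.Pt, D.IsCusp x → D.decomp x ≤ D.toZ.ker :=
  fun x _ => D.decomp_le_ker_toZ_of_root x

/-- Elementwise form: `toZ d = 1` (i.e. `d ∈ Π^tp_Y`) for every `d` in a decomposition group of a
closed point, hence for every element of any CONJUGATE `γ D_x γ⁻¹` as well (`Ker toZ` is normal).
[cite: MochizukiEtTh2009, §1 p.13] -/
theorem toZ_eq_one_of_mem_conj_decomp (x : D.Pt) (γ : ConjAct D.PiTemp) {d : D.PiTemp}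
    (hd : d ∈ γ • D.decomp x) : D.toZ d = 1 := by
  rw [Subgroup.mem_pointwise_smul_iff_inv_smul_mem] at hd
  have h1 := D.decomp_le_ker_toZ_of_root x hd
  rw [MonoidHom.mem_ker, ConjAct.smul_def, map_mul, map_mul] at h1
  -- toZ (γ⁻¹ d γ) = toZ γ⁻¹ * toZ d * toZ γ = toZ d in the commutative group ℤ
  rw [ConjAct.ofConjAct_inv, map_inv, mul_comm, ← mul_assoc, inv_inv, mul_inv_cancel, one_mul] at h1
  exact h1

/-- **Kernel certificate of the redundancy**: an `OncePuncturedData` for `D` is assembled from the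
group-level data and the parameters (P1), (P2), (P4), (P5) ALONE — the (P3) slot is filled by
`decomp_le_ker_toZ_of_root`. (For the v-next of abc-iut-L2-t7's `OncePuncturedData`.)
[cite: MochizukiEtTh2009, §1 p.13] -/
theorem nonempty_oncePuncturedData_of_P1_P2_P4_P5 (gl : D.toTemperedCurve.GroupLevelData)
    (hP1 : D.augHat.toMonoidHom.ker = D.DeltaHat) (hP2 : ∃ x : D.Pt, D.IsCusp x)
    (hP4 : ∀ x : D.Pt, D.IsCusp x → (D.decomp x).map D.aug.toMonoidHom = D.GK)
    (hP5 : D.IsEtThOrigin) : Nonempty D.OncePuncturedData :=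
  ⟨{ toGroupLevelData := gl
     ker_augHat := hP1
     exists_cusp := hP2
     decomp_le_ker_toZ := fun x _ => D.decomp_le_ker_toZ_of_root x
     map_aug_decomp := hP4
     origin := hP5 }⟩

end Literature.AnabelianGeometry.EtaleTheta.ThetaSetting
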